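import Literature.NumberTheory.Automorphic.UnitaryGroupBorelInduction                    -- ★ `xiTorusChar`, `cmXiTorusChar`, `torusCharPair`, `quotConj`, `normOneUnits`, `torusU`, `torusEntry`, `torusDetNormOne`
import Summits.HodgeConjecture.HodgeConjecture.Theorems.F0P2oStubDictTorusChar            -- ★ (F0P2-p02) `exists_quotConj_eq_of_nonsplit` (local Hilbert 90 at a non-split place)
import HarnessLib

/-!
# R90-TF · S5 (Rogawski Ch. 13.3) — (LT) «ξ-LABEL INJECTIVITY ON THE TORUS»: `χ_ξ` DETERMINES `ξ = (η₁, η₂)`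

Cell `hodgecm-mathlib`, crux H413 (`stmt-HodgeConjecture-24833`, lane `--supports … --as helper`), route of record `HCCMUnconditional` (no route verbs;
count-neutral).  Programme R90-TF, section S5 = Ch. 13.3 (base `R90-C133`); seat K2E2-p12 (g8), dealt BY NAME «DEAL #13 → K2E2-p12 (g8): (LT)
`Theorems/R90S5CmXiTorusCharInjective.lean`» (R90-C133-plan (g0), R90 bus 2026-09-04T16:13:43Z; row (LT) of R90-C133-p02's DEAL #10 census «`P`
determines `ξ`», consumer S9 (S-U)).  THEOREMS ONLY (no `def`, no instance, no notation, no named fact, no `sorry`); imports ★ only.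
HONEST LABEL: HC_CM is proved only modulo the 7 printed citations (2 remaining named inputs: hLiu418 = stmt-HodgeConjecture-24832,
h413 = stmt-HodgeConjecture-24833) until rung 0 closes; this file is unconditional local group theory (closes no socket).

SETTING (★ `UnitaryGroupBorelInduction` §2–§3).  `R` a commutative (locally compact topological) ring with an INVOLUTION `σ` (`E_v = L ⊗ L⁺_v`,
`σ = c ⊗ 1`), `E¹ = normOneUnits σ = {β : σ(β) β = 1}`, `quotConj : α ↦ α/σ(α) : Rˣ →* E¹`, the diagonal torus `T = {d(α, β, σ(α)⁻¹)}` of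
`U(σ, Φ₃)(R)` (★ `torusU`, ★ `glDiagonal_mem_unitaryGroupOfForm_antidiagonal_iff`), and print's character of case (2) of §12.2 attached to a
one-dimensional `ξ = (η₁, η₂)` of `H = U(2) × U(1)` (`η₁, η₂ ∈ Hom(E¹, ℂ^×)`; `μ` the fixed character with `μ|F^× = ω_{E/F}`):
`χ_ξ(d(α, β, σ(α)⁻¹)) = η₁(α/σ(α)) · μ(α) · ‖α‖^{1/2} · η₂(α β σ(α)⁻¹)` (★ `xiTorusChar σ J hJ hσ 0 μ η₁ η₂`, ★ `xiTorusChar_apply`; at the CM data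
★ `cmXiTorusChar L v μ η₁ η₂`, ★ `cmXiTorusChar_apply`).
THE MATHEMATICS.  Evaluate at the two one-parameter sub-tori: `t_β = d(1, β, 1)` gives `χ_ξ(t_β) = η₂(β)`, so `χ_ξ = χ_{ξ′} ⇒ η₂ = η₂′`; then
`t_α = d(α, 1, σ(α)⁻¹)` gives `η₁(α/σ(α)) · η₂(α/σ(α)) = η₁′(α/σ(α)) · η₂′(α/σ(α))`, so `η₁ ∘ quotConj = η₁′ ∘ quotConj` — AT EVERY PLACE; and `η₁ = η₁′`
as soon as `quotConj` is SURJECTIVE (local Hilbert 90: every norm-one unit is `α/σ(α)`), which is ★ at a NON-SPLIT place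
(★ `F0P2oStubDictTorusChar.exists_quotConj_eq_of_nonsplit`); at a split place it is true but not yet ★ (GAP «H90-split», kept hypothesis-first as `h90`).
* §1 (generic `R, σ, J = Φ₃`, coordinate `0`) the torus witnesses `exists_torusU_entry_zero_eq_one_det_eq` (`t_β`), `exists_torusU_entry_zero_eq_det_eq_quotConj`
  (`t_α`); `xiTorusChar_zero_eq_imp` (`η₁ ∘ quotConj = η₁′ ∘ quotConj ∧ η₂ = η₂′`), `xiTorusChar_zero_injective_of_quotConj_surjective` (`η₁ = η₁′ ∧ η₂ = η₂′`).
* §2 (CM pair, `U(Φ₃)(L⁺_v)`) `cmXiTorusChar_eq_imp` (every `v`), **`cmXiTorusChar_injective_of_nonsplit`** (the dealt shape at a non-split `v`), `…_iff_of_nonsplit`,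
  and the `Function.Injective` packaging on pairs `(η₁, η₂)`; `cmXiTorusChar_injective_of_quotConj_surjective` (any `v`, hypothesis-first `h90`).
* §3 (`N = 2` twin, generic) on `U(σ, Φ₂)` the torus `{d(α, σ(α)⁻¹)}` is ONE-parameter with `det = α/σ(α)`, so `torusCharPair … 0 χ₁ χ₂` determines exactly the
  product `χ₁ · (χ₂ ∘ quotConj)` — `torusCharPair_zero_two_eq_iff` (the pair `(χ₁, χ₂)` is NOT determined: `(χ₁ · (χ₂ ∘ quotConj), 1)` gives the same torus character).

## References
* [Rogawski1990] J. D. Rogawski, *Automorphic Representations of Unitary Groups in Three Variables*, Ann. of Math. Stud. 123 (1990): §1.10 p. 9 (the torus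
  `M = {d(α, β, ᾱ⁻¹)}`), §12.1 p. 171 (`χ = (χ₁, χ₂)`), §12.2 pp. 173–174 (`χ_ξ`, case (2)), §13.3 (ξ-families).
* [CasselsFrohlichANT1967] J. W. S. Cassels, A. Fröhlich (eds.), *Algebraic Number Theory* (1967), Ch. V §2.7 Prop. 5 (Hilbert 90).
-/

set_option autoImplicit false
-- the mandated namespace repeats `HodgeConjecture.HodgeConjecture`, as in every `Theorems/*.lean` of this sub-problem
set_option linter.dupNamespace false

noncomputable section

open NumberField IsDedekindDomain
open scoped Matrix MatrixGroups

open Literature.NumberTheory.Automorphic Literature.NumberTheory.Automorphic.UnitaryGroup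

namespace Summit.HodgeConjecture.HodgeConjecture.R90.S5

/-! ## §1 Generic `(R, σ)`, `J = Φ₃`, coordinate `0`: the two torus witnesses and the injectivity of `(η₁, η₂) ↦ χ_ξ` -/

section Generic

variable {R : Type*} [CommRing R] (σ : R →+* R) (J : Matrix (Fin 3) (Fin 3) R)

/-- **The torus element `t_β = d(1, β, 1)`** of `U(σ, Φ₃)(R)` for `β ∈ E¹` (`σ(β) β = 1`): first entry `1`, determinant `β`.
[cite: Rogawski1990, §1.10 p. 9; §12.1 p. 171] -/
theorem exists_torusU_entry_zero_eq_one_det_eq (hJ : J = (StdForm.antidiagonal 3).over R) (β : ↥(normOneUnits σ)) :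
    ∃ t : ↥(torusU σ J), torusEntry σ J 0 t = 1 ∧ torusDetNormOne σ J hJ t = β := by
  set d : Fin 3 → Rˣ := ![1, (β : Rˣ), 1] with hd
  have hmem : glDiagonal 3 R d ∈ unitaryGroupOfForm σ J := by
    rw [hJ, glDiagonal_mem_unitaryGroupOfForm_antidiagonal_iff]
    intro i
    fin_cases i
    · show σ ((d 2 : Rˣ) : R) * (d 0 : R) = 1
      simp [hd]
    · show σ ((d 1 : Rˣ) : R) * (d 1 : R) = 1
      simp only [hd, Matrix.cons_val_one]
      exact (mem_normOneUnits_iff _).1 β.2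
    · show σ ((d 0 : Rˣ) : R) * (d 2 : R) = 1
      simp [hd]
  refine ⟨⟨⟨glDiagonal 3 R d, hmem⟩, ⟨d, rfl⟩⟩, ?_, ?_⟩
  · rw [torusEntry_eq_of_glDiagonal_eq σ J 0 _ d rfl]; rfl
  · apply Subtype.ext
    rw [coe_torusDetNormOne, torusDet_eq_of_glDiagonal_eq σ J _ d rfl, Fin.prod_univ_three]
    simp [hd]

/-- **The torus element `t_α = d(α, 1, σ(α)⁻¹)`** of `U(σ, Φ₃)(R)` (`σ` an involution) for a unit `α`: first entry `α`, determinant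
`α/σ(α) = quotConj α`. [cite: Rogawski1990, §1.10 p. 9; §12.1 p. 172] -/
theorem exists_torusU_entry_zero_eq_det_eq_quotConj (hJ : J = (StdForm.antidiagonal 3).over R) (hσ : ∀ x : R, σ (σ x) = x) (α : Rˣ) :
    ∃ t : ↥(torusU σ J), torusEntry σ J 0 t = α ∧ torusDetNormOne σ J hJ t = quotConj σ hσ α := by
  set d : Fin 3 → Rˣ := ![α, 1, (Units.map (σ : R →* R) α)⁻¹] with hd
  have h20 : σ (((Units.map (σ : R →* R) α)⁻¹ : Rˣ) : R) * (α : R) = 1 := by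
    rw [Units.coe_map_inv, MonoidHom.coe_coe, hσ, Units.inv_mul]
  have h02 : σ (α : R) * (((Units.map (σ : R →* R) α)⁻¹ : Rˣ) : R) = 1 := by
    rw [Units.coe_map_inv, MonoidHom.coe_coe, ← map_mul, Units.mul_inv, map_one]
  have hmem : glDiagonal 3 R d ∈ unitaryGroupOfForm σ J := by
    rw [hJ, glDiagonal_mem_unitaryGroupOfForm_antidiagonal_iff]
    intro i
    fin_cases i
    · show σ ((d 2 : Rˣ) : R) * (d 0 : R) = 1
      simp only [hd, Matrix.cons_val_zero, Matrix.cons_val_two, Matrix.tail_cons, Matrix.head_cons]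
      exact h20
    · show σ ((d 1 : Rˣ) : R) * (d 1 : R) = 1
      simp [hd]
    · show σ ((d 0 : Rˣ) : R) * (d 2 : R) = 1
      simp only [hd, Matrix.cons_val_zero, Matrix.cons_val_two, Matrix.tail_cons, Matrix.head_cons]
      exact h02
  refine ⟨⟨⟨glDiagonal 3 R d, hmem⟩, ⟨d, rfl⟩⟩, ?_, ?_⟩
  · rw [torusEntry_eq_of_glDiagonal_eq σ J 0 _ d rfl]; rfl
  · apply Subtype.ext
    rw [coe_torusDetNormOne, torusDet_eq_of_glDiagonal_eq σ J _ d rfl, Fin.prod_univ_three, coe_quotConj]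
    simp [hd]

variable [TopologicalSpace R] [IsTopologicalRing R] [LocallyCompactSpace R]

/-- **`χ_ξ = χ_{ξ′} ⇒ η₁ ∘ quotConj = η₁′ ∘ quotConj ∧ η₂ = η₂′`** (generic `R, σ` involutive, `J = Φ₃`, coordinate `0`, any parameter `μ`): evaluation at
`t_β = d(1, β, 1)` gives `η₂ = η₂′`, then at `t_α = d(α, 1, σ(α)⁻¹)` (cancelling `μ(α) · ‖α‖^{1/2} · η₂(α/σ(α))`) gives the pulled-back identity.
[cite: Rogawski1990, §12.2 pp. 173–174; §12.1 p. 172] -/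
theorem xiTorusChar_zero_eq_imp (hJ : J = (StdForm.antidiagonal 3).over R) (hσ : ∀ x : R, σ (σ x) = x) (μ : Rˣ →* ℂˣ)
    {η₁ η₂ η₁' η₂' : ↥(normOneUnits σ) →* ℂˣ} (h : xiTorusChar σ J hJ hσ 0 μ η₁ η₂ = xiTorusChar σ J hJ hσ 0 μ η₁' η₂') :
    η₁.comp (quotConj σ hσ) = η₁'.comp (quotConj σ hσ) ∧ η₂ = η₂' := by
  have h2 : η₂ = η₂' := by
    refine MonoidHom.ext fun β => ?_
    obtain ⟨t, ht0, htd⟩ := exists_torusU_entry_zero_eq_one_det_eq σ J hJ β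
    have ht := DFunLike.congr_fun h t
    rw [xiTorusChar_apply, xiTorusChar_apply, ht0, htd] at ht
    simpa only [map_one, one_mul] using ht
  refine ⟨MonoidHom.ext fun α => ?_, h2⟩
  obtain ⟨t, ht0, htd⟩ := exists_torusU_entry_zero_eq_det_eq_quotConj σ J hJ hσ α
  have ht := DFunLike.congr_fun h t
  rw [xiTorusChar_apply, xiTorusChar_apply, ht0, htd, h2] at ht
  rw [MonoidHom.comp_apply, MonoidHom.comp_apply]
  exact mul_right_cancel (mul_right_cancel (mul_right_cancel ht))

/-- **`(η₁, η₂) ↦ χ_ξ` IS INJECTIVE when `α ↦ α/σ(α)` maps `Rˣ` ONTO `E¹`** (local Hilbert 90, hypothesis-first `h90`): `χ_ξ = χ_{ξ′} ⇒ η₁ = η₁′ ∧ η₂ = η₂′`.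
[cite: Rogawski1990, §12.2 pp. 173–174] [cite: CasselsFrohlichANT1967, Ch. V §2.7 Prop. 5] -/
theorem xiTorusChar_zero_injective_of_quotConj_surjective (hJ : J = (StdForm.antidiagonal 3).over R) (hσ : ∀ x : R, σ (σ x) = x)
    (h90 : Function.Surjective (quotConj σ hσ)) (μ : Rˣ →* ℂˣ) {η₁ η₂ η₁' η₂' : ↥(normOneUnits σ) →* ℂˣ}
    (h : xiTorusChar σ J hJ hσ 0 μ η₁ η₂ = xiTorusChar σ J hJ hσ 0 μ η₁' η₂') : η₁ = η₁' ∧ η₂ = η₂' := by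
  obtain ⟨h1, h2⟩ := xiTorusChar_zero_eq_imp σ J hJ hσ μ h
  refine ⟨MonoidHom.ext fun β => ?_, h2⟩
  obtain ⟨α, rfl⟩ := h90 β
  exact DFunLike.congr_fun h1 α

end Generic

/-! ## §2 The CM pair: `χ_ξ` on the torus of `U(Φ₃)(L⁺_v)` (★ `cmXiTorusChar`) -/

section CM

variable (L : Type) [Field L] [NumberField L] [IsCMField L] (v : HeightOneSpectrum (𝓞 ↥(maximalRealSubfield L)))

/-- **AT EVERY FINITE PLACE `v`: `χ_ξ = χ_{ξ′} ⇒ η₁ ∘ quotConj = η₁′ ∘ quotConj ∧ η₂ = η₂′`** (the pulled-back character `η̃₁(α) = η₁(α/ᾱ)` and `η₂` are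
determined by `χ_ξ`; no hypothesis on `v` or `μ`). [cite: Rogawski1990, §12.2 pp. 173–174] -/
theorem cmXiTorusChar_eq_imp (μ : (LocalRing L v)ˣ →* ℂˣ)
    {η₁ η₂ η₁' η₂' : ↥(normOneUnits (conjLocal L (IsCMField.complexConj L) v)) →* ℂˣ}
    (h : cmXiTorusChar L v μ η₁ η₂ = cmXiTorusChar L v μ η₁' η₂') :
    η₁.comp (quotConj (conjLocal L (IsCMField.complexConj L) v) (conjLocal_conjLocal_cm L v)) =
        η₁'.comp (quotConj (conjLocal L (IsCMField.complexConj L) v) (conjLocal_conjLocal_cm L v)) ∧ η₂ = η₂' :=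
  xiTorusChar_zero_eq_imp (conjLocal L (IsCMField.complexConj L) v) (cmLocalForm L 3 v) (cmLocalForm_eq_over L 3 v)
    (conjLocal_conjLocal_cm L v) μ h

/-- **AT EVERY FINITE PLACE `v`, hypothesis-first local Hilbert 90 (`h90 : α ↦ α/ᾱ` onto `E¹_v`): `χ_ξ = χ_{ξ′} ⇒ η₁ = η₁′ ∧ η₂ = η₂′`.**
(`h90` is ★ at a non-split `v` — next theorem; at a split `v` it is the GAP «H90-split».) [cite: Rogawski1990, §12.2 pp. 173–174] [cite: CasselsFrohlichANT1967, Ch. V §2.7 Prop. 5] -/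
theorem cmXiTorusChar_injective_of_quotConj_surjective
    (h90 : Function.Surjective (quotConj (conjLocal L (IsCMField.complexConj L) v) (conjLocal_conjLocal_cm L v)))
    (μ : (LocalRing L v)ˣ →* ℂˣ) {η₁ η₂ η₁' η₂' : ↥(normOneUnits (conjLocal L (IsCMField.complexConj L) v)) →* ℂˣ}
    (h : cmXiTorusChar L v μ η₁ η₂ = cmXiTorusChar L v μ η₁' η₂') : η₁ = η₁' ∧ η₂ = η₂' :=
  xiTorusChar_zero_injective_of_quotConj_surjective (conjLocal L (IsCMField.complexConj L) v) (cmLocalForm L 3 v) (cmLocalForm_eq_over L 3 v)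
    (conjLocal_conjLocal_cm L v) h90 μ h

/-- **(LT) «ξ-LABEL INJECTIVITY ON THE TORUS» AT A NON-SPLIT PLACE** (every `w ∣ v` is `c`-fixed): `χ_ξ = χ_{ξ′} ⇒ η₁ = η₁′ ∧ η₂ = η₂′` — the dealt shape;
local Hilbert 90 is ★ `F0P2oStubDictTorusChar.exists_quotConj_eq_of_nonsplit`. [cite: Rogawski1990, §12.2 pp. 173–174; §13.3] [cite: CasselsFrohlichANT1967, Ch. V §2.7 Prop. 5] -/
theorem cmXiTorusChar_injective_of_nonsplit (hv : ∀ w : PlacesOver L v, IsCMField.complexConj L • w.1 = w.1)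
    (μ : (LocalRing L v)ˣ →* ℂˣ) {η₁ η₂ η₁' η₂' : ↥(normOneUnits (conjLocal L (IsCMField.complexConj L) v)) →* ℂˣ}
    (h : cmXiTorusChar L v μ η₁ η₂ = cmXiTorusChar L v μ η₁' η₂') : η₁ = η₁' ∧ η₂ = η₂' :=
  cmXiTorusChar_injective_of_quotConj_surjective L v
    (fun β => Cruxes.H413.F0P2oStubDictTorusChar.exists_quotConj_eq_of_nonsplit L v hv β) μ h

/-- **`χ_ξ = χ_{ξ′} ↔ (η₁, η₂) = (η₁′, η₂′)`** at a non-split place. [cite: Rogawski1990, §12.2 pp. 173–174] -/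
theorem cmXiTorusChar_eq_iff_of_nonsplit (hv : ∀ w : PlacesOver L v, IsCMField.complexConj L • w.1 = w.1)
    (μ : (LocalRing L v)ˣ →* ℂˣ) (η₁ η₂ η₁' η₂' : ↥(normOneUnits (conjLocal L (IsCMField.complexConj L) v)) →* ℂˣ) :
    cmXiTorusChar L v μ η₁ η₂ = cmXiTorusChar L v μ η₁' η₂' ↔ η₁ = η₁' ∧ η₂ = η₂' :=
  ⟨cmXiTorusChar_injective_of_nonsplit L v hv μ, fun h => by rw [h.1, h.2]⟩

/-- **`(η₁, η₂) ↦ χ_ξ` is `Function.Injective`** at a non-split place (packaging for «`P` determines `ξ`»). [cite: Rogawski1990, §12.2 pp. 173–174; §13.3] -/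
theorem cmXiTorusChar_pair_injective_of_nonsplit (hv : ∀ w : PlacesOver L v, IsCMField.complexConj L • w.1 = w.1)
    (μ : (LocalRing L v)ˣ →* ℂˣ) :
    Function.Injective fun p : (↥(normOneUnits (conjLocal L (IsCMField.complexConj L) v)) →* ℂˣ) ×
        (↥(normOneUnits (conjLocal L (IsCMField.complexConj L) v)) →* ℂˣ) => cmXiTorusChar L v μ p.1 p.2 :=
  fun _ _ h => Prod.ext (cmXiTorusChar_injective_of_nonsplit L v hv μ h).1 (cmXiTorusChar_injective_of_nonsplit L v hv μ h).2

end CM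

/-! ## §3 The `N = 2` twin: on `U(σ, Φ₂)` the torus character `(χ₁, χ₂)` determines exactly `χ₁ · (χ₂ ∘ quotConj)` -/

section Two

variable {R : Type*} [CommRing R] (σ : R →+* R) (J : Matrix (Fin 2) (Fin 2) R)

/-- **Every torus element of `U(σ, Φ₂)(R)` is `d(α, σ(α)⁻¹)`** (`σ` an involution): first entry `α`, determinant `α/σ(α) = quotConj α`.
[cite: Rogawski1990, §1.10 p. 9; §12.1 p. 171] -/
theorem torusDetNormOne_two_eq_quotConj_torusEntry (hJ : J = (StdForm.antidiagonal 2).over R) (hσ : ∀ x : R, σ (σ x) = x)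
    (t : ↥(torusU σ J)) : torusDetNormOne σ J hJ t = quotConj σ hσ (torusEntry σ J 0 t) := by
  obtain ⟨d, hd⟩ := t.2
  have hdU : glDiagonal 2 R d ∈ unitaryGroupOfForm σ ((StdForm.antidiagonal 2).over R) := by
    rw [← hJ, hd]; exact (t : ↥(unitaryGroupOfForm σ J)).2
  have hrel := (glDiagonal_mem_unitaryGroupOfForm_antidiagonal_iff σ 2 d).1 hdU 1
  -- `σ(d 0) · d 1 = 1`, i.e. `d 1 = σ(d 0)⁻¹`
  have h10 : (d 1 : R) = (((Units.map (σ : R →* R) (d 0))⁻¹ : Rˣ) : R) := by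
    have h : σ ((d (Fin.rev 1) : Rˣ) : R) * (d 1 : R) = 1 := hrel
    have hrev : (Fin.rev 1 : Fin 2) = 0 := rfl
    rw [hrev] at h
    rw [Units.coe_map_inv, MonoidHom.coe_coe]
    have hu : σ (d 0 : R) * σ (((d 0)⁻¹ : Rˣ) : R) = 1 := by rw [← map_mul, Units.mul_inv, map_one]
    calc (d 1 : R) = σ (d 0 : R) * σ (((d 0)⁻¹ : Rˣ) : R) * (d 1 : R) := by rw [hu, one_mul]
      _ = σ (((d 0)⁻¹ : Rˣ) : R) := by rw [mul_right_comm, h, one_mul]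
  apply Subtype.ext
  apply Units.ext
  rw [coe_torusDetNormOne, torusDet_eq_of_glDiagonal_eq σ J t d hd, Fin.prod_univ_two, coe_quotConj,
    torusEntry_eq_of_glDiagonal_eq σ J 0 t d hd, Units.val_mul, Units.val_mul, h10]

/-- **The torus element `d(α, σ(α)⁻¹)` of `U(σ, Φ₂)(R)`** for a unit `α` (`σ` an involution). [cite: Rogawski1990, §1.10 p. 9] -/
theorem exists_torusU_two_entry_zero_eq (hJ : J = (StdForm.antidiagonal 2).over R) (hσ : ∀ x : R, σ (σ x) = x) (α : Rˣ) :
    ∃ t : ↥(torusU σ J), torusEntry σ J 0 t = α := by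
  set d : Fin 2 → Rˣ := ![α, (Units.map (σ : R →* R) α)⁻¹] with hd
  have h10 : σ (((Units.map (σ : R →* R) α)⁻¹ : Rˣ) : R) * (α : R) = 1 := by
    rw [Units.coe_map_inv, MonoidHom.coe_coe, hσ, Units.inv_mul]
  have h01 : σ (α : R) * (((Units.map (σ : R →* R) α)⁻¹ : Rˣ) : R) = 1 := by
    rw [Units.coe_map_inv, MonoidHom.coe_coe, ← map_mul, Units.mul_inv, map_one]
  have hmem : glDiagonal 2 R d ∈ unitaryGroupOfForm σ J := by
    rw [hJ, glDiagonal_mem_unitaryGroupOfForm_antidiagonal_iff]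
    intro i
    fin_cases i
    · show σ ((d 1 : Rˣ) : R) * (d 0 : R) = 1
      simp only [hd, Matrix.cons_val_zero, Matrix.cons_val_one]
      exact h10
    · show σ ((d 0 : Rˣ) : R) * (d 1 : R) = 1
      simp only [hd, Matrix.cons_val_zero, Matrix.cons_val_one]
      exact h01
  exact ⟨⟨⟨glDiagonal 2 R d, hmem⟩, ⟨d, rfl⟩⟩, by rw [torusEntry_eq_of_glDiagonal_eq σ J 0 _ d rfl]; rfl⟩

/-- **`N = 2`: `(χ₁, χ₂) = (χ₁′, χ₂′)` AS TORUS CHARACTERS OF `U(σ, Φ₂)` IFF `χ₁ · (χ₂ ∘ quotConj) = χ₁′ · (χ₂′ ∘ quotConj)`** — the torus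
`{d(α, σ(α)⁻¹)}` is one-parameter with `det = α/σ(α)`, so the pair `(χ₁, χ₂)` is NOT determined (e.g. `(χ₁ · (χ₂ ∘ quotConj), 1)` gives the same
character); only the product is. [cite: Rogawski1990, §12.1 pp. 171–172; §11.1 p. 161] -/
theorem torusCharPair_zero_two_eq_iff (hJ : J = (StdForm.antidiagonal 2).over R) (hσ : ∀ x : R, σ (σ x) = x)
    (χ₁ χ₁' : Rˣ →* ℂˣ) (χ₂ χ₂' : ↥(normOneUnits σ) →* ℂˣ) :
    torusCharPair σ J hJ 0 χ₁ χ₂ = torusCharPair σ J hJ 0 χ₁' χ₂' ↔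
      χ₁ * χ₂.comp (quotConj σ hσ) = χ₁' * χ₂'.comp (quotConj σ hσ) := by
  constructor
  · intro h
    refine MonoidHom.ext fun α => ?_
    obtain ⟨t, ht⟩ := exists_torusU_two_entry_zero_eq σ J hJ hσ α
    have hx := DFunLike.congr_fun h t
    rw [torusCharPair_apply, torusCharPair_apply, torusDetNormOne_two_eq_quotConj_torusEntry σ J hJ hσ, ht] at hx
    rw [MonoidHom.mul_apply, MonoidHom.mul_apply, MonoidHom.comp_apply, MonoidHom.comp_apply]
    exact hx
  · intro h
    refine MonoidHom.ext fun t => ?_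
    have hx := DFunLike.congr_fun h (torusEntry σ J 0 t)
    rw [MonoidHom.mul_apply, MonoidHom.mul_apply, MonoidHom.comp_apply, MonoidHom.comp_apply] at hx
    rw [torusCharPair_apply, torusCharPair_apply, torusDetNormOne_two_eq_quotConj_torusEntry σ J hJ hσ]
    exact hx

end Two

end Summit.HodgeConjecture.HodgeConjecture.R90.S5

end
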